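import Summits.QuantumFields.GaugeBoot.CylinderDensity
import Mathlib.MeasureTheory.Function.L2Space
import HarnessLib

/-!
# Reflection positivity from continuous cylinder observables (gauge-boot, Class-B identification)

HONEST FRAMING (cell `pub-gaugeboot`, page 1 of every file): the venture produces certified bounds
on lattice expectations at stated coupling, gauge group, dimension and torus size; NOT a mass gap,
NOT a continuum limit, NOT a string tension; NOT Yang–Mills-summit-bearing (barriers
`FixedCouplingUltralocality`, `PerturbativeInvisibility`).

`IsReflectionPositiveFor Θ S μ` (`ClassB.lean`) asks `0 ≤ ∫ (F∘Θ)‾ F dμ` for every bounded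
MEASURABLE `F` supported in `S`. This file proves that it suffices to check bounded CONTINUOUS
CYLINDER observables supported in `S`, provided `μ` is a probability measure invariant under the
(measurable) reflection `Θ` — the form in which reflection positivity passes to infinite-volume
limit points, which are defined by their continuous cylinder integrals:

* `rpForm_sub_le` — the sesquilinear form `B(F) = ∫ (F∘Θ)‾ F dμ` is Lipschitz on bounded sets of
  `L²(μ)`: `‖B F - B G‖ ≤ ‖F - G‖₂ (‖F‖₂ + ‖G‖₂)` (Cauchy–Schwarz in `L²(μ; ℂ)` and
  `‖H∘Θ‖₂ = ‖H‖₂`);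
* `IsReflectionPositiveFor.of_continuous_cylinder` — the closure statement, by the `L²`-density of
  continuous cylinder observables among bounded measurable `S`-supported ones
  (`exists_continuous_cylinder_eLpNorm_sub_le`, applied to real and imaginary parts).

References: K. Osterwalder, E. Seiler, Ann. Phys. 110 (1978) 440, §2; J. Glimm, A. Jaffe, Quantum
Physics (1987) §6.1 (RP is closed under limits); standard measure theory.
-/

noncomputable section

open MeasureTheory Filter Topology
open scoped ENNReal ComplexConjugate InnerProductSpace ComplexOrder
open Literature.MathematicalPhysics.QuantumLattice

namespace Summit.QuantumFields.GaugeBoot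

variable {d : ℕ} {G : Type*} [Group G] [TopologicalSpace G] [IsTopologicalGroup G] [CompactSpace G]
  [T2Space G] [SecondCountableTopology G] [MeasurableSpace G] [BorelSpace G]

/-! ## The RP form and its `L²` continuity -/

section Form

variable {μ : Measure (LGConfig d G)} [IsProbabilityMeasure μ] {Θ : LGConfig d G → LGConfig d G}

omit [Group G] [TopologicalSpace G] [IsTopologicalGroup G] [CompactSpace G] [T2Space G]
  [SecondCountableTopology G] [BorelSpace G] in
/-- A bounded measurable complex observable is in `L²(μ)`. -/
theorem memLp_two_of_bound {H : LGConfig d G → ℂ} (hH : Measurable H) {C : ℝ} (hC : ∀ U, ‖H U‖ ≤ C) :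
    MemLp H 2 μ :=
  MemLp.of_bound hH.aestronglyMeasurable C (ae_of_all _ hC)

omit [Group G] [TopologicalSpace G] [IsTopologicalGroup G] [CompactSpace G] [T2Space G]
  [SecondCountableTopology G] [BorelSpace G] [IsProbabilityMeasure μ] in
/-- `‖H ∘ Θ‖₂ = ‖H‖₂` for a measure-preserving `Θ`. -/
theorem eLpNorm_comp_eq (hΘ : MeasurePreserving Θ μ μ) {H : LGConfig d G → ℂ} (hH : Measurable H) :
    eLpNorm (H ∘ Θ) 2 μ = eLpNorm H 2 μ := by
  rw [← eLpNorm_map_measure (hH.aestronglyMeasurable) hΘ.measurable.aemeasurable, hΘ.map_eq]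

omit [Group G] [TopologicalSpace G] [IsTopologicalGroup G] [CompactSpace G] [T2Space G]
  [SecondCountableTopology G] [BorelSpace G] in
/-- The RP form as an `L²` inner product: `∫ (H∘Θ)‾ K dμ = ⟪(H∘Θ), K⟫_{L²}`. -/
theorem integral_conj_mul_eq_inner (hΘ : MeasurePreserving Θ μ μ) {H K : LGConfig d G → ℂ}
    (hH : Measurable H) {CH : ℝ} (hCH : ∀ U, ‖H U‖ ≤ CH) (hK : Measurable K) {CK : ℝ}
    (hCK : ∀ U, ‖K U‖ ≤ CK) :
    ∫ U, conj (H (Θ U)) * K U ∂μ =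
      ⟪(memLp_two_of_bound (μ := μ) (hH.comp hΘ.measurable) (C := CH) fun U => hCH (Θ U)).toLp (H ∘ Θ),
        (memLp_two_of_bound (μ := μ) hK hCK).toLp K⟫_ℂ := by
  rw [L2.inner_def]
  refine integral_congr_ae ?_
  filter_upwards [MemLp.coeFn_toLp (memLp_two_of_bound (μ := μ) (hH.comp hΘ.measurable) (C := CH)
      fun U => hCH (Θ U)), MemLp.coeFn_toLp (memLp_two_of_bound (μ := μ) hK hCK)] with U h1 h2
  rw [h1, h2, RCLike.inner_apply', Function.comp_apply]

omit [Group G] [TopologicalSpace G] [IsTopologicalGroup G] [CompactSpace G] [T2Space G]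
  [SecondCountableTopology G] [BorelSpace G] in
/-- **`L²` continuity of the RP form**: for bounded measurable `F, G`,
`‖∫ (F∘Θ)‾ F - ∫ (G∘Θ)‾ G‖ ≤ ‖F - G‖₂ (‖F‖₂ + ‖G‖₂)` (all norms in `L²(μ)`, `Θ` preserving `μ`). -/
theorem rpForm_sub_le (hΘ : MeasurePreserving Θ μ μ) {F K : LGConfig d G → ℂ} (hF : Measurable F)
    {CF : ℝ} (hCF : ∀ U, ‖F U‖ ≤ CF) (hK : Measurable K) {CK : ℝ} (hCK : ∀ U, ‖K U‖ ≤ CK) :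
    ‖(∫ U, conj (F (Θ U)) * F U ∂μ) - ∫ U, conj (K (Θ U)) * K U ∂μ‖ ≤
      (eLpNorm (F - K) 2 μ).toReal * ((eLpNorm F 2 μ).toReal + (eLpNorm K 2 μ).toReal) := by
  have hFm : MemLp F 2 μ := memLp_two_of_bound hF hCF
  have hKm : MemLp K 2 μ := memLp_two_of_bound hK hCK
  have hFΘm : MemLp (F ∘ Θ) 2 μ :=
    memLp_two_of_bound (hF.comp hΘ.measurable) (C := CF) fun U => hCF (Θ U)
  have hKΘm : MemLp (K ∘ Θ) 2 μ :=
    memLp_two_of_bound (hK.comp hΘ.measurable) (C := CK) fun U => hCK (Θ U)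
  rw [integral_conj_mul_eq_inner hΘ hF hCF hF hCF, integral_conj_mul_eq_inner hΘ hK hCK hK hCK]
  set a := hFΘm.toLp (F ∘ Θ)
  set b := hFm.toLp F
  set a' := hKΘm.toLp (K ∘ Θ)
  set b' := hKm.toLp K
  have hsplit : ⟪a, b⟫_ℂ - ⟪a', b'⟫_ℂ = ⟪a - a', b⟫_ℂ + ⟪a', b - b'⟫_ℂ := by
    rw [inner_sub_left, inner_sub_right]; ring
  have ha : ‖a - a'‖ = (eLpNorm (F - K) 2 μ).toReal := by
    rw [show a - a' = (hFΘm.sub hKΘm).toLp (F ∘ Θ - K ∘ Θ) from (MemLp.toLp_sub hFΘm hKΘm).symm,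
      Lp.norm_toLp, show (F ∘ Θ - K ∘ Θ : LGConfig d G → ℂ) = (F - K) ∘ Θ from rfl,
      eLpNorm_comp_eq hΘ (hF.sub hK)]
  have hb : ‖b - b'‖ = (eLpNorm (F - K) 2 μ).toReal := by
    rw [show b - b' = (hFm.sub hKm).toLp (F - K) from (MemLp.toLp_sub hFm hKm).symm, Lp.norm_toLp]
  have hb0 : ‖b‖ = (eLpNorm F 2 μ).toReal := Lp.norm_toLp _ _
  have ha' : ‖a'‖ = (eLpNorm K 2 μ).toReal := by
    rw [Lp.norm_toLp, eLpNorm_comp_eq hΘ hK]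
  rw [hsplit]
  calc ‖⟪a - a', b⟫_ℂ + ⟪a', b - b'⟫_ℂ‖ ≤ ‖⟪a - a', b⟫_ℂ‖ + ‖⟪a', b - b'⟫_ℂ‖ := norm_add_le _ _
    _ ≤ ‖a - a'‖ * ‖b‖ + ‖a'‖ * ‖b - b'‖ :=
        add_le_add (norm_inner_le_norm _ _) (norm_inner_le_norm _ _)
    _ = (eLpNorm (F - K) 2 μ).toReal * ((eLpNorm F 2 μ).toReal + (eLpNorm K 2 μ).toReal) := by
        rw [ha, hb, hb0, ha']; ring

end Form

/-! ## Complex continuous cylinder approximation -/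

section Approx

/-- **Complex version of the density step**: a bounded measurable complex `S`-supported
observable is within `ε` in `L²(μ)` of a bounded continuous cylinder `S`-supported one. -/
theorem exists_continuous_cylinder_approx_complex (μ : Measure (LGConfig d G)) [IsProbabilityMeasure μ]
    (S : Set (ZdEdge d)) {F : LGConfig d G → ℂ} (hF : Measurable F) {C : ℝ} (hC : ∀ U, ‖F U‖ ≤ C)
    (hFS : DependsOn F S) {ε : ℝ} (hε : 0 < ε) :
    ∃ (K : LGConfig d G → ℂ) (T : Finset (ZdEdge d)), IsCylinder K T ∧ Continuous K ∧
      (∃ C' : ℝ, ∀ U, ‖K U‖ ≤ C') ∧ DependsOn K S ∧ (eLpNorm (F - K) 2 μ).toReal ≤ ε := by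
  classical
  have hε2 : ENNReal.ofReal (ε / 2) ≠ 0 := by
    simpa [ENNReal.ofReal_eq_zero, not_le] using half_pos hε
  have hre : ∀ U, |(F U).re| ≤ C := fun U => (Complex.abs_re_le_norm _).trans (hC U)
  have him : ∀ U, |(F U).im| ≤ C := fun U => (Complex.abs_im_le_norm _).trans (hC U)
  obtain ⟨g₁, T₁, hT₁, hg₁c, ⟨C₁, hC₁⟩, hS₁, hε₁⟩ := exists_continuous_cylinder_eLpNorm_sub_le μ S
    (Complex.measurable_re.comp hF) hre (fun U V h => by simp only [Function.comp_apply, hFS h]) hε2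
  obtain ⟨g₂, T₂, hT₂, hg₂c, ⟨C₂, hC₂⟩, hS₂, hε₂⟩ := exists_continuous_cylinder_eLpNorm_sub_le μ S
    (Complex.measurable_im.comp hF) him (fun U V h => by simp only [Function.comp_apply, hFS h]) hε2
  set K : LGConfig d G → ℂ := fun U => (g₁ U : ℂ) + (g₂ U : ℂ) * Complex.I with hK
  refine ⟨K, T₁ ∪ T₂, ?_, ?_, ⟨|C₁| + |C₂|, fun U => ?_⟩, ?_, ?_⟩
  · intro U V hUV
    simp only [hK]
    rw [hT₁ fun e he => hUV e (by simp [Finset.mem_coe.1 he]),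
      hT₂ fun e he => hUV e (by simp [Finset.mem_coe.1 he])]
  · exact (Complex.continuous_ofReal.comp hg₁c).add
      ((Complex.continuous_ofReal.comp hg₂c).mul continuous_const)
  · simp only [hK]
    refine (norm_add_le _ _).trans (add_le_add ?_ ?_)
    · rw [Complex.norm_real, Real.norm_eq_abs]; exact (hC₁ U).trans (le_abs_self _)
    · rw [norm_mul, Complex.norm_I, mul_one, Complex.norm_real, Real.norm_eq_abs]
      exact (hC₂ U).trans (le_abs_self _)
  · intro U V hUV
    simp only [hK, hS₁ hUV, hS₂ hUV]
  · -- `F - K = ((re F - g₁) : ℂ) + ((im F - g₂) : ℂ) I`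
    have hdecomp : F - K = (fun U => (((fun U => (F U).re) - g₁) U : ℂ)) +
        fun U => (((fun U => (F U).im) - g₂) U : ℂ) * Complex.I := by
      funext U
      simp only [hK, Pi.sub_apply, Pi.add_apply, Complex.ofReal_sub]
      rw [← Complex.re_add_im (F U)]
      simp only [Complex.add_re, Complex.ofReal_re, Complex.mul_re, Complex.I_re, mul_zero,
        Complex.ofReal_im, Complex.I_im, mul_one, sub_self, add_zero, Complex.add_im,
        Complex.mul_im, zero_add]
      ring
    have hm1 : AEStronglyMeasurable (fun U => (((fun U => (F U).re) - g₁) U : ℂ)) μ :=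
      (Complex.measurable_ofReal.comp ((Complex.measurable_re.comp hF).sub
        hg₁c.measurable)).aestronglyMeasurable
    have hm2 : AEStronglyMeasurable (fun U => (((fun U => (F U).im) - g₂) U : ℂ) * Complex.I) μ :=
      ((Complex.measurable_ofReal.comp ((Complex.measurable_im.comp hF).sub
        hg₂c.measurable)).mul_const _).aestronglyMeasurable
    have h1 : eLpNorm (fun U => (((fun U => (F U).re) - g₁) U : ℂ)) 2 μ =
        eLpNorm ((fun U => (F U).re) - g₁) 2 μ :=
      eLpNorm_congr_norm_ae (ae_of_all _ fun U => by rw [Complex.norm_real])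
    have h2 : eLpNorm (fun U => (((fun U => (F U).im) - g₂) U : ℂ) * Complex.I) 2 μ =
        eLpNorm ((fun U => (F U).im) - g₂) 2 μ :=
      eLpNorm_congr_norm_ae (ae_of_all _ fun U => by
        rw [norm_mul, Complex.norm_I, mul_one, Complex.norm_real])
    have hsum : eLpNorm (F - K) 2 μ ≤ ENNReal.ofReal (ε / 2) + ENNReal.ofReal (ε / 2) := by
      rw [hdecomp]
      refine (eLpNorm_add_le hm1 hm2 one_le_two).trans ?_
      rw [h1, h2]
      exact add_le_add hε₁ hε₂
    have hfin : ENNReal.ofReal (ε / 2) + ENNReal.ofReal (ε / 2) ≠ ∞ := by simp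
    calc (eLpNorm (F - K) 2 μ).toReal ≤ (ENNReal.ofReal (ε / 2) + ENNReal.ofReal (ε / 2)).toReal :=
          ENNReal.toReal_mono hfin hsum
      _ = ε := by
          rw [ENNReal.toReal_add ENNReal.ofReal_ne_top ENNReal.ofReal_ne_top,
            ENNReal.toReal_ofReal (by linarith)]
          ring

end Approx

/-! ## The closure theorem -/

section Closure

/-- **Reflection positivity is decided by continuous cylinder observables.** Let `μ` be a
probability measure on `LGConfig d G` preserved by the measurable map `Θ`, and `S` a set of links.
If `0 ≤ ∫ (F∘Θ)‾ F dμ` for every bounded continuous cylinder observable `F` depending only on the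
links of `S`, then `μ` is reflection positive for `(Θ, S)` in the sense of `ClassB.lean` (all
bounded measurable `S`-supported `F`). -/
theorem IsReflectionPositiveFor.of_continuous_cylinder {μ : Measure (LGConfig d G)}
    [IsProbabilityMeasure μ] {Θ : LGConfig d G → LGConfig d G} (hΘ : MeasurePreserving Θ μ μ)
    {S : Set (ZdEdge d)}
    (h : ∀ (F : LGConfig d G → ℂ) (T : Finset (ZdEdge d)), IsCylinder F T → Continuous F →
      (∃ C : ℝ, ∀ U, ‖F U‖ ≤ C) → DependsOn F S →
        0 ≤ ∫ U, (starRingEnd ℂ) (F (Θ U)) * F U ∂μ) :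
    IsReflectionPositiveFor Θ S μ := by
  intro F hF hFb hFS
  obtain ⟨CF, hCF⟩ := hFb
  set B : ℂ := ∫ U, (starRingEnd ℂ) (F (Θ U)) * F U ∂μ with hB
  set M : ℝ := (eLpNorm F 2 μ).toReal with hM
  have hM0 : 0 ≤ M := ENNReal.toReal_nonneg
  -- for every `η > 0`: `re B ≥ -η` and `|im B| ≤ η`
  have key : ∀ η : ℝ, 0 < η → -η ≤ B.re ∧ |B.im| ≤ η := by
    intro η hη
    set ε : ℝ := min 1 (η / (2 * M + 1)) with hεdef
    have hε : 0 < ε := lt_min one_pos (div_pos hη (by linarith))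
    have hε1 : ε ≤ 1 := min_le_left _ _
    have hεη : ε * (2 * M + 1) ≤ η := by
      have : ε ≤ η / (2 * M + 1) := min_le_right _ _
      rwa [le_div_iff₀ (by linarith)] at this
    obtain ⟨K, T, hKT, hKc, ⟨CK, hCK⟩, hKS, hFK⟩ :=
      exists_continuous_cylinder_approx_complex μ S hF hCF hFS hε
    have hKm : Measurable K := hKc.measurable
    have hpos : 0 ≤ ∫ U, (starRingEnd ℂ) (K (Θ U)) * K U ∂μ := h K T hKT hKc ⟨CK, hCK⟩ hKS
    have hdiff := rpForm_sub_le hΘ hF hCF hKm hCK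
    -- `‖K‖₂ ≤ ‖F‖₂ + ε`
    have hFm : MemLp F 2 μ := memLp_two_of_bound hF hCF
    have hKmm : MemLp K 2 μ := memLp_two_of_bound hKm hCK
    have hKnorm : (eLpNorm K 2 μ).toReal ≤ M + ε := by
      have htri : eLpNorm K 2 μ ≤ eLpNorm F 2 μ + eLpNorm (F - K) 2 μ := by
        have : K = F - (F - K) := by simp
        rw [this]
        exact (eLpNorm_sub_le hFm.aestronglyMeasurable (hFm.sub hKmm).aestronglyMeasurable
          one_le_two).trans (by rw [← this])
      calc (eLpNorm K 2 μ).toReal ≤ (eLpNorm F 2 μ + eLpNorm (F - K) 2 μ).toReal :=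
            ENNReal.toReal_mono (ENNReal.add_ne_top.2 ⟨hFm.eLpNorm_ne_top, (hFm.sub hKmm).eLpNorm_ne_top⟩)
              htri
        _ = M + (eLpNorm (F - K) 2 μ).toReal :=
            ENNReal.toReal_add hFm.eLpNorm_ne_top (hFm.sub hKmm).eLpNorm_ne_top
        _ ≤ M + ε := by linarith
    have hbound : ‖B - ∫ U, (starRingEnd ℂ) (K (Θ U)) * K U ∂μ‖ ≤ η := by
      refine hdiff.trans ?_
      calc (eLpNorm (F - K) 2 μ).toReal * ((eLpNorm F 2 μ).toReal + (eLpNorm K 2 μ).toReal)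
          ≤ ε * (M + (M + ε)) := mul_le_mul hFK (by linarith) (by positivity) hε.le
        _ ≤ ε * (2 * M + 1) := by nlinarith
        _ ≤ η := hεη
    obtain ⟨hKre, hKim⟩ := Complex.nonneg_iff.1 hpos
    have hre := (Complex.abs_re_le_norm _).trans hbound
    have him := (Complex.abs_im_le_norm _).trans hbound
    rw [Complex.sub_re] at hre
    rw [Complex.sub_im, ← hKim, sub_zero] at him
    constructor
    · have := neg_abs_le (B.re - (∫ U, (starRingEnd ℂ) (K (Θ U)) * K U ∂μ).re)
      linarith
    · exact him
  have hre : 0 ≤ B.re := by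
    by_contra hlt
    have hlt' : B.re < 0 := not_le.1 hlt
    have := (key (-B.re / 2) (by linarith)).1
    linarith
  have him : B.im = 0 := by
    by_contra hne
    have hpos : 0 < |B.im| := abs_pos.2 hne
    have := (key (|B.im| / 2) (by linarith)).2
    linarith
  exact Complex.nonneg_iff.2 ⟨hre, him.symm⟩

end Closure

end Summit.QuantumFields.GaugeBoot
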